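import Literature.Claims.NS.Aksman2026
import Literature.Analysis.FluidPDE.TimeDependentLinearFlow
import Literature.Analysis.FluidPDE.NSQuasipotential
import Literature.Claims.NS.ClayR3HorizonBridge
import HarnessLib

/-!
# C175 `Aksman2026` — SALVAGE records for the recorded NON-UNIQUENESS face (Thm 11 (i)/(iii)):
# TRUE in the typed class by the unsteady linear strain flows (no energy clause), FALSE for
# finite-energy classical solutions (D-0090 NS-CLAIMS; salvage seat `ns-claims-salvage-p3`)

`Literature.Claims.NS.Aksman2026.ClaimedBranching` (skeleton p552632, l.151) types Thm 11 (i)/(iii) p.6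
l.18–21 («these solutions are not unique: the flow branches at vortex reconnection», abstract p.1 l.11–12)
as: some smooth divergence-free rapidly decaying datum carries two classical solutions `(U,P)`, `(V,Q)` of the
unforced system on a common slab `[0,T)` with `U 0 = V 0 = u₀` and `U t ≠ V t` for some `t ∈ [0,T)`. It is a
RECORDED face (not consumed by `claim_of_steps`, not keyed). Two kernel records, no new definition:

* `claimedBranching_holds_wideClass : ClaimedBranching` — TRUE AS TYPED, for a reason unrelated to the print's
  reconnection mechanism: `IsClassicalNSSolutionOn` carries no energy/decay clause (CARD §3 Δ5), and from
  the ZERO datum the rest state and the unsteady linear strain flow `V(t,x) = t·(x₀, −x₁, 0)` (pressure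
  `−½⟨x, (M + t²M²)x⟩`, `M = diag(1,−1,0)`; Craik–Criminale / Drazin Ex. 2.19, tree
  `Literature.Analysis.FluidPDE.LinearFlow.isClassicalNSSolutionOn`) are two classical solutions on `[0,1)`
  that differ at `t = ½`. This is a typing-width record (the F3 pattern of the cell), not a statement about
  the print's mechanism. [cite: Drazin2002, Ex. 2.19] [cite: CraikCriminale1986, §2]
* `not_branching_finiteEnergy` — in the PHYSICAL class the face is FALSE: two classical solutions of the
  unforced system on `[0,T)` from the same Clay datum, each with finite energy `sup_{[0,T')} ∫|u|² < ∞` on the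
  closed sub-slabs, coincide at every `t ∈ [0,T)` (Tao 2013 Cor. 11.4, tree
  `IsClassicalNSSolutionOn.eq_of_finiteEnergy`). Smooth finite-energy solutions do not branch.
  [cite: Tao2013Localisation, Cor. 11.4] [cite: Aksman2026, Thm 11 (i),(iii) p.6 l.18–21]

WHAT THIS IS NOT: not a claim about NS regularity or blow-up; not a claim about any author beyond the
typed locator.
-/

noncomputable section

set_option linter.dupNamespace false

open Set MeasureTheory Filter
open scoped Topology ENNReal NNReal ContDiff InnerProductSpace RealInnerProductSpace

namespace Summit.NavierStokesRegularity.NavierStokesRegularity.Theorems.Aksman2026Salvage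

open Literature.Analysis.FluidPDE Literature.Claims.NS Literature.Claims.NS.Aksman2026
  Literature.Claims.NS.ClayVariants

/-- The zero field on `ℝ³` is a Clay datum: smooth, divergence-free, rapidly decaying. [folklore] -/
theorem zero_isClayDatum :
    ContDiff ℝ ∞ (0 : E3 → E3) ∧ NSWave0.IsDivFree (0 : E3 → E3) ∧ HasRapidSpatialDecay (0 : E3 → E3) := by
  refine ⟨contDiff_const, fun x => ?_, fun n K => ⟨0, fun x => ?_⟩⟩
  · simp [NSWave0.divergence, show (0 : E3 → E3) = fun _ => 0 from rfl]
  · simp [iteratedFDeriv_fun_zero, show (0 : E3 → E3) = fun _ => (0 : E3) from rfl]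

/-- **Thm 11 (i)/(iii) AS TYPED holds — by the unsteady linear strain flows, not by reconnection.** From the
zero datum, `U ≡ 0` and `V(t,x) = t·M x` with `M = diag(1,−1,0)` (trace `0`, `M' + (tM)² = M + t²M²`
symmetric) are two classical solutions of the unforced system on `[0,1)` (any `ν`), equal at `t = 0`,
different at `t = ½`. [cite: Drazin2002, Ex. 2.19] [cite: Aksman2026, Thm 11 (i),(iii) p.6 l.18–21] -/
theorem claimedBranching_holds_wideClass : ClaimedBranching := by
  -- the strain matrix `M = e₀ ⊗ e₀* − e₁ ⊗ e₁*`
  set M : E3 →L[ℝ] E3 :=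
    (EuclideanSpace.proj (0 : Fin 3) : E3 →L[ℝ] ℝ).smulRight (EuclideanSpace.single (0 : Fin 3) (1 : ℝ)) -
      (EuclideanSpace.proj (1 : Fin 3) : E3 →L[ℝ] ℝ).smulRight (EuclideanSpace.single (1 : Fin 3) (1 : ℝ))
    with hM
  have hMapply : ∀ x : E3, M x = x 0 • EuclideanSpace.single (0 : Fin 3) (1 : ℝ) -
      x 1 • EuclideanSpace.single (1 : Fin 3) (1 : ℝ) := fun x => by
    simp [hM, ContinuousLinearMap.smulRight_apply]
  -- coordinates of `M x`
  have hMcoord : ∀ x : E3, ∀ j : Fin 3, M x j = if j = 0 then x 0 else if j = 1 then -x 1 else 0 := by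
    intro x j
    rw [hMapply]
    fin_cases j <;> simp
  -- symmetry of `M`
  have hMsym : ∀ x y : E3, ⟪M x, y⟫ = ⟪x, M y⟫ := by
    intro x y
    simp only [PiLp.inner_apply, RCLike.inner_apply, conj_trivial, Fin.sum_univ_three, hMcoord]
    simp
  -- trace of `M` vanishes
  have hMtr : LinearMap.trace ℝ E3 (M : E3 →ₗ[ℝ] E3) = 0 := by
    rw [hM, ContinuousLinearMap.toLinearMap_sub, map_sub,
      show (((EuclideanSpace.proj (0 : Fin 3) : E3 →L[ℝ] ℝ).smulRight
          (EuclideanSpace.single (0 : Fin 3) (1 : ℝ)) : E3 →L[ℝ] E3) : E3 →ₗ[ℝ] E3) =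
        ((EuclideanSpace.proj (0 : Fin 3) : E3 →L[ℝ] ℝ) : E3 →ₗ[ℝ] ℝ).smulRight
          (EuclideanSpace.single (0 : Fin 3) (1 : ℝ)) from rfl,
      show (((EuclideanSpace.proj (1 : Fin 3) : E3 →L[ℝ] ℝ).smulRight
          (EuclideanSpace.single (1 : Fin 3) (1 : ℝ)) : E3 →L[ℝ] E3) : E3 →ₗ[ℝ] E3) =
        ((EuclideanSpace.proj (1 : Fin 3) : E3 →L[ℝ] ℝ) : E3 →ₗ[ℝ] ℝ).smulRight
          (EuclideanSpace.single (1 : Fin 3) (1 : ℝ)) from rfl,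
      LinearMap.trace_smulRight, LinearMap.trace_smulRight]
    simp
  -- the time-dependent coefficient `S t = t • M`, `S' = M`
  set S : ℝ → E3 →L[ℝ] E3 := fun t => t • M with hS
  set S' : ℝ → E3 →L[ℝ] E3 := fun _ => M with hS'
  have hT : UniqueDiffOn ℝ (Ico (0 : ℝ) 1) := uniqueDiffOn_Ico 0 1
  have hV : IsClassicalNSSolutionOn (Ico (0 : ℝ) 1) 1 (fun _ _ => (0 : E3))
      (LinearFlow.velocity S fun _ => 0) (LinearFlow.pressure S S' (fun _ => 0) (fun _ => 0) fun _ => 0) := by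
    refine LinearFlow.isClassicalNSSolutionOn S S' (fun _ => 0) (fun _ => 0) (fun _ => 0) hT 1 ?_ ?_
      contDiffOn_const contDiffOn_const contDiffOn_const ?_ ?_ ?_ ?_
    · exact (contDiff_id.smul contDiff_const).contDiffOn
    · exact contDiffOn_const
    · intro t _
      exact (((hasDerivAt_id t).smul_const M).congr_deriv (one_smul _ _)).hasDerivWithinAt
    · intro t _
      exact (hasDerivAt_const t (0 : E3)).hasDerivWithinAt
    · intro t _
      rw [hS]
      simp only [ContinuousLinearMap.toLinearMap_smul, map_smul, hMtr, smul_zero]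
    · intro t _ x y
      simp only [LinearFlow.ccMatrix_apply, hS, hS', smul_apply, map_smul,
        inner_add_left, inner_add_right, inner_smul_left, inner_smul_right, hMsym, conj_trivial]
  refine ⟨1, 0, 1, 0, LinearFlow.velocity S fun _ => 0, 0,
    LinearFlow.pressure S S' (fun _ => 0) (fun _ => 0) fun _ => 0, one_pos, one_pos,
    zero_isClayDatum.1, zero_isClayDatum.2.1, zero_isClayDatum.2.2, isClassicalNSSolutionOn_zero _ _, ?_,
    rfl, ?_, ⟨1 / 2, ⟨by norm_num, by norm_num⟩, ?_⟩⟩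
  · exact hV
  · funext x
    simp [LinearFlow.velocity, hS]
  · -- `U(½) = 0` but `V(½) e₀ = ½ e₀ ≠ 0`
    intro h
    have h1 := congrFun h (EuclideanSpace.single (0 : Fin 3) (1 : ℝ))
    have h2 := congrArg (fun v : E3 => v 0) h1
    simp [LinearFlow.velocity, hS, hMcoord] at h2

/-- **In the finite-energy class smooth solutions do not branch** (Tao 2013 Cor. 11.4, tree
`IsClassicalNSSolutionOn.eq_of_finiteEnergy`): two classical solutions of the unforced system on `[0,T)`
(`ν > 0`) from the same smooth rapidly decaying datum, each with energy bounded on every closed sub-slab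
`[0,T']`, `T' < T`, agree at every time of `[0,T)`. Hence the recorded face `ClaimedBranching` has no witness
among finite-energy solutions. [cite: Tao2013Localisation, Cor. 11.4] [cite: Aksman2026, Thm 11 (i),(iii) p.6 l.18–21] -/
theorem not_branching_finiteEnergy {ν : ℝ} (hν : 0 < ν) {u₀ : E3 → E3} (hu₀ : ContDiff ℝ ∞ u₀)
    (hdec : HasRapidSpatialDecay u₀) {T : ℝ} {U V : ℝ → E3 → E3} {P Q : ℝ → E3 → ℝ}
    (hU : IsClassicalNSSolutionOn (Ico 0 T) ν 0 U P) (hV : IsClassicalNSSolutionOn (Ico 0 T) ν 0 V Q)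
    (hU0 : U 0 = u₀) (hV0 : V 0 = u₀)
    (hEU : ∀ T' : ℝ, 0 < T' → T' < T → ∃ A : ℝ≥0∞, A < ⊤ ∧ ∀ t ∈ Icc 0 T', ∫⁻ x, ‖U t x‖ₑ ^ 2 ≤ A)
    (hEV : ∀ T' : ℝ, 0 < T' → T' < T → ∃ A : ℝ≥0∞, A < ⊤ ∧ ∀ t ∈ Icc 0 T', ∫⁻ x, ‖V t x‖ₑ ^ 2 ≤ A)
    {t : ℝ} (ht : t ∈ Ico 0 T) : U t = V t := by
  rcases ht.1.eq_or_lt with h0 | ht0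
  · subst h0
    rw [hU0, hV0]
  · have hsub : Icc 0 t ⊆ Ico 0 T := fun s hs => ⟨hs.1, hs.2.trans_lt ht.2⟩
    have hU' := hU.mono hsub (uniqueDiffOn_Icc ht0)
    have hV' := hV.mono hsub (uniqueDiffOn_Icc ht0)
    exact IsClassicalNSSolutionOn.eq_of_finiteEnergy hν
      (memLp_fderiv_two_of_rapidDecay hdec (hu₀.of_le (by norm_cast))) hU' hV' hU0 hV0
      (hEU t ht0 ht.2) (hEV t ht0 ht.2) ⟨ht.1, le_rfl⟩ le_rfl

/-- Packaging: the typed face holds and, simultaneously, no finite-energy pair witnesses it — the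
non-uniqueness recorded in the skeleton's class comes from infinite-energy (linearly growing) solutions only.
[cite: Aksman2026, Thm 11 (i),(iii) p.6 l.18–21] [cite: Tao2013Localisation, Cor. 11.4] -/
theorem claimedBranching_wide_not_finiteEnergy :
    ClaimedBranching ∧
      ¬ ∃ (ν : ℝ) (u₀ : E3 → E3) (T : ℝ) (U V : ℝ → E3 → E3) (P Q : ℝ → E3 → ℝ),
        0 < ν ∧ 0 < T ∧ ContDiff ℝ ∞ u₀ ∧ NSWave0.IsDivFree u₀ ∧ HasRapidSpatialDecay u₀ ∧
          IsClassicalNSSolutionOn (Ico 0 T) ν 0 U P ∧ IsClassicalNSSolutionOn (Ico 0 T) ν 0 V Q ∧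
          U 0 = u₀ ∧ V 0 = u₀ ∧
          (∀ T' : ℝ, 0 < T' → T' < T → ∃ A : ℝ≥0∞, A < ⊤ ∧ ∀ t ∈ Icc 0 T', ∫⁻ x, ‖U t x‖ₑ ^ 2 ≤ A) ∧
          (∀ T' : ℝ, 0 < T' → T' < T → ∃ A : ℝ≥0∞, A < ⊤ ∧ ∀ t ∈ Icc 0 T', ∫⁻ x, ‖V t x‖ₑ ^ 2 ≤ A) ∧
          ∃ t ∈ Ico 0 T, U t ≠ V t := by
  refine ⟨claimedBranching_holds_wideClass, ?_⟩
  rintro ⟨ν, u₀, T, U, V, P, Q, hν, -, hu₀, -, hdec, hU, hV, hU0, hV0, hEU, hEV, t, ht, hne⟩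
  exact hne (not_branching_finiteEnergy hν hu₀ hdec hU hV hU0 hV0 hEU hEV ht)

end Summit.NavierStokesRegularity.NavierStokesRegularity.Theorems.Aksman2026Salvage

end

-- WHAT THIS IS NOT: not a claim about NS regularity or blow-up; not a claim about any author beyond the typed locator.
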